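import Summits.ValiantsHypothesis.ValiantsHypothesis.Theses.TauConst
import Literature.Computability.AlgebraicComplexity.TauConjectureDischarge

/-!
# Route TauConst — the known crux `TauBurgisser` (stmt-ValiantsHypothesis-0337)

Bürgisser 2009, Main Thm. 1.2: the Shub–Smale τ-conjecture implies that `τ(per_n)` is not
polynomially bounded — discharged in the tree (`TauConjectureDischarge.lean`,
`not_isPBounded_constantFreeComplexity_perPoly_of_shubSmaleTauConjecture`); the route item is that
implication by value. Candidate proof on file (refuter route-review), landed under Theorems
(prover-only). Honest framing: a known implication; the τ-conjecture itself is open.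
-/

set_option linter.dupNamespace false

namespace Summit.ValiantsHypothesis.ValiantsHypothesis.Theorems.TauConst

open Summit.ValiantsHypothesis.ValiantsHypothesis.Theses.TauConst

/-- **Item `TauBurgisser` (stmt-ValiantsHypothesis-0337, crux (known)), PROVED**: the tree's
discharge of Bürgisser 2009, Thm. 1.2. [cite: Burgisser2009, Thm. 1.2] -/
theorem tauBurgisser_proof : TauBurgisser :=
  fun h => Literature.Computability.AlgebraicComplexity.not_isPBounded_constantFreeComplexity_perPoly_of_shubSmaleTauConjecture h

end Summit.ValiantsHypothesis.ValiantsHypothesis.Theorems.TauConst
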